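import Mathlib
import HarnessLib
import Summits.RiemannHypothesis.RiemannHypothesis.Theorems.PfPersistenceFfDialLine

/-!
# Function-field mirror: CONVEX readers are blind to sandwiched fakes at fixed `q`
(pub-rhpf, seat ffmirror-2; HONEST FRAMING: mechanism/rigidity campaign — no RH claims)

Corollary of the dial-line lemma `weilWindowForm_dial_midpoint` (`PfPersistenceFfDialLine`):
a "reader" of the window form `T_M(q, ·)` at fixed `(q, M)` is modelled by its ACCEPTANCE REGION
`S ⊆ Matrix (Fin (M+1)) (Fin (M+1)) ℂ`.  If `S` is convex over `ℝ` (eigenvalue or trace floors with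
absolute or scale-free thresholds, PSD / spectrahedral / linear-inequality tests, their sectorwise
versions — preimages of convex sets under the linear even/odd compressions — and intersections of
such), and `S` accepts the two lattice neighbours `h + x^g`, `h - x^g` of a monic `h` of degree `2g`,
then for every informative window (`M + 1 ≤ 2g`) it accepts `h` itself, because `T_M(q,h)` is the
midpoint of the two accepted forms.  The tower version quantifies over all informative windows at
once (a reader imposing one convex constraint per window).

Use in the cell (pub-rhpf-ffmirror-2 `SEPARATION.md` §12; the census count is DATA there): 129 of
the 143 served RH-true non-realizable Weil polynomials have BOTH lattice neighbours `h ± x^g`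
realizable, so no convex reader rejects them while accepting the realizable population.
Pure algebra + the definition of convexity, [folklore].
-/

set_option linter.dupNamespace false  -- the mandated namespace repeats `RiemannHypothesis`

noncomputable section

open Polynomial

namespace Summit.RiemannHypothesis.RiemannHypothesis.Theorems.PfPersistence.FfAngleTwin

/-- Midpoints of an `ℝ`-convex set of complex matrices: if `X, Z ∈ S` and `X + Z = 2 • Y` then
`Y ∈ S`. [folklore] -/
theorem mem_of_convex_of_midpoint {m n : Type*} {S : Set (Matrix m n ℂ)}
    (hS : Convex ℝ S) {X Y Z : Matrix m n ℂ} (hX : X ∈ S) (hZ : Z ∈ S)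
    (hmid : X + Z = (2 : ℂ) • Y) : Y ∈ S := by
  have h : (1/2 : ℝ) • X + (1/2 : ℝ) • Z ∈ S :=
    hS hX hZ (by norm_num) (by norm_num) (by norm_num)
  have h2 : ((2 : ℂ) • Y) = (2 : ℝ) • Y := by
    rw [← Complex.ofReal_ofNat 2, ← Complex.coe_smul]
  have hY : Y = (1/2 : ℝ) • X + (1/2 : ℝ) • Z := by
    rw [← smul_add, hmid, h2, smul_smul]; norm_num
  rw [hY]; exact h

/-- CONVEX READERS ARE BLIND ALONG THE DIAL (one window): for `h` monic of degree `2g`, `g ≥ 1`,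
integers `a + b = 2c`, a window `M` with `M + 1 ≤ 2g` and an `ℝ`-convex acceptance region `S`:
if `S` accepts `T_M(q, h + a x^g)` and `T_M(q, h + b x^g)` then it accepts `T_M(q, h + c x^g)`.
[folklore] -/
theorem convexReader_accepts_dial (q : ℝ) {h : ℤ[X]} {g : ℕ} (hh : h.Monic)
    (hdeg : h.natDegree = 2 * g) (hg : 1 ≤ g) {a b c : ℤ} (habc : a + b = 2 * c)
    {M : ℕ} (hM : M + 1 ≤ 2 * g) {S : Set (Matrix (Fin (M + 1)) (Fin (M + 1)) ℂ)}
    (hS : Convex ℝ S) (ha : weilWindowForm q (h + C a * X ^ g) M ∈ S)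
    (hb : weilWindowForm q (h + C b * X ^ g) M ∈ S) :
    weilWindowForm q (h + C c * X ^ g) M ∈ S :=
  mem_of_convex_of_midpoint hS ha hb (weilWindowForm_dial_midpoint q hh hdeg hg habc hM)

/-- CONVEX READERS ARE BLIND TO SANDWICHED POLYNOMIALS (one window): if an `ℝ`-convex acceptance
region accepts the window forms of both lattice neighbours `h + x^g` and `h - x^g` of a monic `h` of
degree `2g` (`g ≥ 1`), then for `M + 1 ≤ 2g` it accepts the window form of `h`. [folklore] -/
theorem convexReader_accepts_of_neighbours (q : ℝ) {h : ℤ[X]} {g : ℕ} (hh : h.Monic)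
    (hdeg : h.natDegree = 2 * g) (hg : 1 ≤ g) {M : ℕ} (hM : M + 1 ≤ 2 * g)
    {S : Set (Matrix (Fin (M + 1)) (Fin (M + 1)) ℂ)} (hS : Convex ℝ S)
    (hplus : weilWindowForm q (h + X ^ g) M ∈ S) (hminus : weilWindowForm q (h - X ^ g) M ∈ S) :
    weilWindowForm q h M ∈ S :=
  mem_of_convex_of_midpoint hS hplus hminus (weilWindowForm_neighbours_midpoint q hh hdeg hg hM)

/-- Tower version: a reader imposing one `ℝ`-convex constraint `S M` per informative window
`M + 1 ≤ 2g` that accepts both lattice neighbours `h ± x^g` on every such window accepts `h` on every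
such window. [folklore] -/
theorem convexTowerReader_accepts_of_neighbours (q : ℝ) {h : ℤ[X]} {g : ℕ} (hh : h.Monic)
    (hdeg : h.natDegree = 2 * g) (hg : 1 ≤ g)
    (S : (M : ℕ) → Set (Matrix (Fin (M + 1)) (Fin (M + 1)) ℂ))
    (hS : ∀ M, M + 1 ≤ 2 * g → Convex ℝ (S M))
    (hplus : ∀ M, M + 1 ≤ 2 * g → weilWindowForm q (h + X ^ g) M ∈ S M)
    (hminus : ∀ M, M + 1 ≤ 2 * g → weilWindowForm q (h - X ^ g) M ∈ S M) :
    ∀ M, M + 1 ≤ 2 * g → weilWindowForm q h M ∈ S M := fun M hM =>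
  convexReader_accepts_of_neighbours q hh hdeg hg hM (hS M hM) (hplus M hM) (hminus M hM)

/-- Example of a convex acceptance region: an EIGENVALUE-TYPE FLOOR written as a family of linear
inequalities, `S = {T | ∀ v, θ ‖v‖² ≤ Re ⟪v, T v⟫}` (for Hermitian `T` this is `λ_min(T) ≥ θ`; the
threshold `θ` may be absolute).  Such an `S` is `ℝ`-convex, so the lemmas above apply to it.
[folklore] -/
theorem convex_quadraticFloor {n : Type*} [Fintype n] [DecidableEq n] (θ : ℝ) :
    Convex ℝ {T : Matrix n n ℂ |
      ∀ v : n → ℂ, θ * (∑ i, ‖v i‖ ^ 2) ≤ (star v ⬝ᵥ T.mulVec v).re} := by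
  intro X hX Z hZ a b ha hb hab
  simp only [Set.mem_setOf_eq] at hX hZ ⊢
  intro v
  have hXv := hX v
  have hZv := hZ v
  have hlin : (star v ⬝ᵥ (a • X + b • Z).mulVec v).re
      = a * (star v ⬝ᵥ X.mulVec v).re + b * (star v ⬝ᵥ Z.mulVec v).re := by
    rw [Matrix.add_mulVec, dotProduct_add, Complex.add_re]
    have e1 : (a • X).mulVec v = (a : ℂ) • X.mulVec v := by
      rw [show a • X = (a : ℂ) • X from (Complex.coe_smul a X).symm, Matrix.smul_mulVec]
    have e2 : (b • Z).mulVec v = (b : ℂ) • Z.mulVec v := by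
      rw [show b • Z = (b : ℂ) • Z from (Complex.coe_smul b Z).symm, Matrix.smul_mulVec]
    rw [e1, e2, dotProduct_smul, dotProduct_smul, smul_eq_mul, smul_eq_mul,
      Complex.re_ofReal_mul, Complex.re_ofReal_mul]
  rw [hlin]
  have : θ * ∑ i, ‖v i‖ ^ 2 = a * (θ * ∑ i, ‖v i‖ ^ 2) + b * (θ * ∑ i, ‖v i‖ ^ 2) := by
    rw [← add_mul, hab, one_mul]
  rw [this]
  exact add_le_add (mul_le_mul_of_nonneg_left hXv ha) (mul_le_mul_of_nonneg_left hZv hb)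

end Summit.RiemannHypothesis.RiemannHypothesis.Theorems.PfPersistence.FfAngleTwin

end
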